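import Summits.CriticalPhenomena.PercolationContinuityZ3.Theorems.PercNearOneGluingNoHeavyLowerTailSuperTerminalQuarticHubProb
import HarnessLib

/-!
# Four-terminal hub graphs: the `V4` events as cylinder events and their product probabilities (THEOREM H4, part 3c)

Support file for crux `stmt-CriticalPhenomena-4575` (`NoHeavyLowerTail`), seat `prim-facecert` gen 21 (`--supports stmt-CriticalPhenomena-4575`);
memo `run/shared/lean/prim/prim-l12/prim-facecert/FINDING-gen21-V4-HUB-GRAPHS.md` §1–§3.  No sorries, standard axioms.

Setting: bond percolation `prodBernoulli w` on a finite vertex type, pairwise distinct terminals `c` (port), `u, a, b`, and a BIPARTITE hub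
graph: every hub–hub pair and every terminal–terminal pair has weight `0` (all weighted `K_{4,k}`; the lead's `khub4(k)`).  Off the null event
`bad4` the three `V4` events `Q = {u↔a} ∩ {u↮b} ∩ {c ∤ {u,a,b}}`, `A = {u↔a} ∩ {u↮b} ∩ {c ∤ {u,a}}`, `C = {c ∤ {u,a,b}}` are differences of
separation events (`…SuperTerminalQuarticHubEvents.sepEv`), whose probabilities factor over the hubs with the closed-form factors of
`…SuperTerminalQuarticHubProb`:
`P(Q) = Π_h (n+p)_h − Π_h n_h`, `P(A) = Π_h (n+p+d)_h − Π_h (n+d)_h`, `P(C) = Π_h γ_h`  (`real_Q`, `real_A`, `real_C`).  [this work]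
-/

namespace Summit.CriticalPhenomena.PercolationContinuityZ3.Theorems.SuperTerminalQuarticHubCylinders

open MeasureTheory Set
open Literature.Probability.Percolation Literature.Probability.LatticeModels
open Summit.CriticalPhenomena.PercolationContinuityZ3.Theorems.SuperTerminalQuarticHubEvents
open Summit.CriticalPhenomena.PercolationContinuityZ3.Theorems.SuperTerminalQuarticHubProb
open scoped Classical

variable {V : Type*} [Fintype V] [DecidableEq V]

section iffs
variable {c u a b : V} {ω : BondConfig V}

/-- `sepEv {c}` off the null event: `c` is joined to no other terminal. [this work] -/
theorem sep_c_iff (hcu : c ≠ u) (hca : c ≠ a) (hcb : c ≠ b) (hN : ω ∉ bad4 c u a b) :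
    ω ∈ sepEv {c} c u a b ↔ ¬ (openGraph ω).Reachable c u ∧ ¬ (openGraph ω).Reachable c a ∧ ¬ (openGraph ω).Reachable c b := by
  rw [sepEv_iff (by intro x hx; rw [Finset.mem_singleton] at hx; subst hx; simp) hN]
  simp only [Finset.mem_singleton, forall_eq, Finset.mem_sdiff, mem_terms4]
  constructor
  · intro h
    exact ⟨h u ⟨Or.inr (Or.inl rfl), fun e => hcu e.symm⟩, h a ⟨Or.inr (Or.inr (Or.inl rfl)), fun e => hca e.symm⟩,
      h b ⟨Or.inr (Or.inr (Or.inr rfl)), fun e => hcb e.symm⟩⟩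
  · rintro ⟨h1, h2, h3⟩ y ⟨hy, hyc⟩
    rcases hy with rfl | rfl | rfl | rfl
    · exact (hyc rfl).elim
    · exact h1
    · exact h2
    · exact h3

/-- `sepEv {b}` off the null event. [this work] -/
theorem sep_b_iff (hcb : c ≠ b) (hub : u ≠ b) (hab : a ≠ b) (hN : ω ∉ bad4 c u a b) :
    ω ∈ sepEv {b} c u a b ↔ ¬ (openGraph ω).Reachable b c ∧ ¬ (openGraph ω).Reachable b u ∧ ¬ (openGraph ω).Reachable b a := by
  rw [sepEv_iff (by intro x hx; rw [Finset.mem_singleton] at hx; subst hx; simp) hN]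
  simp only [Finset.mem_singleton, forall_eq, Finset.mem_sdiff, mem_terms4]
  constructor
  · intro h
    exact ⟨h c ⟨Or.inl rfl, hcb⟩, h u ⟨Or.inr (Or.inl rfl), hub⟩, h a ⟨Or.inr (Or.inr (Or.inl rfl)), hab⟩⟩
  · rintro ⟨h1, h2, h3⟩ y ⟨hy, hyb⟩
    rcases hy with rfl | rfl | rfl | rfl
    · exact h1
    · exact h2
    · exact h3
    · exact (hyb rfl).elim

/-- `sepEv {u}` off the null event. [this work] -/
theorem sep_u_iff (hcu : c ≠ u) (hua : u ≠ a) (hub : u ≠ b) (hN : ω ∉ bad4 c u a b) :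
    ω ∈ sepEv {u} c u a b ↔ ¬ (openGraph ω).Reachable u c ∧ ¬ (openGraph ω).Reachable u a ∧ ¬ (openGraph ω).Reachable u b := by
  rw [sepEv_iff (by intro x hx; rw [Finset.mem_singleton] at hx; subst hx; simp) hN]
  simp only [Finset.mem_singleton, forall_eq, Finset.mem_sdiff, mem_terms4]
  constructor
  · intro h
    exact ⟨h c ⟨Or.inl rfl, hcu⟩, h a ⟨Or.inr (Or.inr (Or.inl rfl)), fun e => hua e.symm⟩,
      h b ⟨Or.inr (Or.inr (Or.inr rfl)), fun e => hub e.symm⟩⟩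
  · rintro ⟨h1, h2, h3⟩ y ⟨hy, hyu⟩
    rcases hy with rfl | rfl | rfl | rfl
    · exact h1
    · exact (hyu rfl).elim
    · exact h2
    · exact h3

/-- `sepEv {a}` off the null event. [this work] -/
theorem sep_a_iff (hca : c ≠ a) (hua : u ≠ a) (hab : a ≠ b) (hN : ω ∉ bad4 c u a b) :
    ω ∈ sepEv {a} c u a b ↔ ¬ (openGraph ω).Reachable a c ∧ ¬ (openGraph ω).Reachable a u ∧ ¬ (openGraph ω).Reachable a b := by
  rw [sepEv_iff (by intro x hx; rw [Finset.mem_singleton] at hx; subst hx; simp) hN]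
  simp only [Finset.mem_singleton, forall_eq, Finset.mem_sdiff, mem_terms4]
  constructor
  · intro h
    exact ⟨h c ⟨Or.inl rfl, hca⟩, h u ⟨Or.inr (Or.inl rfl), hua⟩, h b ⟨Or.inr (Or.inr (Or.inr rfl)), fun e => hab e.symm⟩⟩
  · rintro ⟨h1, h2, h3⟩ y ⟨hy, hya⟩
    rcases hy with rfl | rfl | rfl | rfl
    · exact h1
    · exact h2
    · exact (hya rfl).elim
    · exact h3

/-- `sepEv {u, a}` off the null event: no open path between `{u,a}` and `{c,b}`. [this work] -/
theorem sep_ua_iff (hcu : c ≠ u) (hca : c ≠ a) (hub : u ≠ b) (hab : a ≠ b) (hN : ω ∉ bad4 c u a b) :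
    ω ∈ sepEv {u, a} c u a b ↔ (¬ (openGraph ω).Reachable u c ∧ ¬ (openGraph ω).Reachable u b) ∧
      (¬ (openGraph ω).Reachable a c ∧ ¬ (openGraph ω).Reachable a b) := by
  rw [sepEv_iff (by intro x hx; simp only [Finset.mem_insert, Finset.mem_singleton] at hx; rcases hx with rfl | rfl <;> simp) hN]
  simp only [Finset.mem_insert, Finset.mem_singleton, forall_eq_or_imp, forall_eq, Finset.mem_sdiff, mem_terms4, not_or]
  constructor
  · rintro ⟨h1, h2⟩
    exact ⟨⟨h1 c ⟨Or.inl rfl, hcu, hca⟩, h1 b ⟨Or.inr (Or.inr (Or.inr rfl)), Ne.symm hub, Ne.symm hab⟩⟩,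
      ⟨h2 c ⟨Or.inl rfl, hcu, hca⟩, h2 b ⟨Or.inr (Or.inr (Or.inr rfl)), Ne.symm hub, Ne.symm hab⟩⟩⟩
  · rintro ⟨⟨h1, h2⟩, ⟨h3, h4⟩⟩
    refine ⟨fun y ⟨hy, hyu, hya⟩ => ?_, fun y ⟨hy, hyu, hya⟩ => ?_⟩
    · rcases hy with rfl | rfl | rfl | rfl
      · exact h1
      · exact (hyu rfl).elim
      · exact (hya rfl).elim
      · exact h2
    · rcases hy with rfl | rfl | rfl | rfl
      · exact h3
      · exact (hyu rfl).elim
      · exact (hya rfl).elim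
      · exact h4

end iffs

/-! ## The `V4` events as differences of separation events (off the null event) -/

section events
variable {c u a b : V}

/-- `Q`: off the null event, `{u↔a} ∩ {u↮b} ∩ {c isolated} = (sepEv{c} ∩ sepEv{b}) ∖ (sepEv{c} ∩ sepEv{b} ∩ sepEv{u})`. [this work] -/
theorem memQ_iff (hcu : c ≠ u) (hca : c ≠ a) (hcb : c ≠ b) (hua : u ≠ a) (hub : u ≠ b) (hab : a ≠ b)
    {ω : BondConfig V} (hN : ω ∉ bad4 c u a b) :
    ω ∈ (openConn u a ∩ (openConn u b)ᶜ ∩ ((openConn c u)ᶜ ∩ (openConn c a)ᶜ ∩ (openConn c b)ᶜ) : Set (BondConfig V)) ↔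
      ω ∈ (sepEv {c} c u a b ∩ sepEv {b} c u a b) \ (sepEv {c} c u a b ∩ sepEv {b} c u a b ∩ sepEv {u} c u a b) := by
  simp only [mem_inter_iff, mem_compl_iff, mem_sdiff, openConn, mem_setOf_eq, sep_c_iff hcu hca hcb hN, sep_b_iff hcb hub hab hN,
    sep_u_iff hcu hua hub hN]
  constructor
  · rintro ⟨⟨hua', hub'⟩, ⟨hcu', hca'⟩, hcb'⟩
    refine ⟨⟨⟨hcu', hca', hcb'⟩, fun h => hcb' h.symm, fun h => hub' h.symm, fun h => hub' (hua'.trans h.symm)⟩, ?_⟩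
    rintro ⟨-, -, h2, -⟩
    exact h2 hua'
  · rintro ⟨⟨⟨hcu', hca', hcb'⟩, hbc, hbu, hba⟩, h2⟩
    refine ⟨⟨?_, fun h => hbu h.symm⟩, ⟨hcu', hca'⟩, hcb'⟩
    by_contra hua'
    exact h2 ⟨⟨⟨hcu', hca', hcb'⟩, hbc, hbu, hba⟩, fun h => hcu' h.symm, hua', fun h => hbu h.symm⟩

/-- `A`: off the null event, `{u↔a} ∩ {u↮b} ∩ {c↮u} ∩ {c↮a} = sepEv{u,a} ∖ (sepEv{u} ∩ sepEv{a})`. [this work] -/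
theorem memA_iff (hcu : c ≠ u) (hca : c ≠ a) (hua : u ≠ a) (hub : u ≠ b) (hab : a ≠ b)
    {ω : BondConfig V} (hN : ω ∉ bad4 c u a b) :
    ω ∈ (openConn u a ∩ (openConn u b)ᶜ ∩ ((openConn c u)ᶜ ∩ (openConn c a)ᶜ) : Set (BondConfig V)) ↔
      ω ∈ sepEv {u, a} c u a b \ (sepEv {u} c u a b ∩ sepEv {a} c u a b) := by
  simp only [mem_inter_iff, mem_compl_iff, mem_sdiff, openConn, mem_setOf_eq, sep_ua_iff hcu hca hub hab hN, sep_u_iff hcu hua hub hN,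
    sep_a_iff hca hua hab hN]
  constructor
  · rintro ⟨⟨hua', hub'⟩, hcu', hca'⟩
    refine ⟨⟨⟨fun h => hcu' h.symm, hub'⟩, fun h => hca' h.symm, fun h => hub' (hua'.trans h)⟩, ?_⟩
    rintro ⟨⟨-, h2, -⟩, -⟩
    exact h2 hua'
  · rintro ⟨⟨⟨huc, hub'⟩, hac, hab'⟩, h2⟩
    refine ⟨⟨?_, hub'⟩, fun h => huc h.symm, fun h => hac h.symm⟩
    by_contra hua'
    exact h2 ⟨⟨huc, hua', hub'⟩, hac, fun h => hua' h.symm, hab'⟩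

/-- `C`: off the null event, `{c isolated} = sepEv{c}`. [this work] -/
theorem memC_iff (hcu : c ≠ u) (hca : c ≠ a) (hcb : c ≠ b) {ω : BondConfig V} (hN : ω ∉ bad4 c u a b) :
    ω ∈ ((openConn c u)ᶜ ∩ (openConn c a)ᶜ ∩ (openConn c b)ᶜ : Set (BondConfig V)) ↔ ω ∈ sepEv {c} c u a b := by
  simp only [mem_inter_iff, mem_compl_iff, openConn, mem_setOf_eq, sep_c_iff hcu hca hcb hN, and_assoc]

/-- `B ⊇`: off the null event, `sepEv{b} ∩ {u ↔ a} ⊆ {u↔a} ∩ {u↮b} ∩ {c↮b}`. [this work] -/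
theorem memB_of (hcb : c ≠ b) (hub : u ≠ b) (hab : a ≠ b) {ω : BondConfig V} (hN : ω ∉ bad4 c u a b)
    (hb : ω ∈ sepEv {b} c u a b) (hua' : (openGraph ω).Reachable u a) :
    ω ∈ (openConn u a ∩ (openConn u b)ᶜ ∩ (openConn c b)ᶜ : Set (BondConfig V)) := by
  rw [sep_b_iff hcb hub hab hN] at hb
  simp only [mem_inter_iff, mem_compl_iff, openConn, mem_setOf_eq]
  exact ⟨⟨hua', fun h => hb.2.1 h.symm⟩, fun h => hb.1 h.symm⟩

end events

/-! ## Probabilities: measure identities and products over the hubs -/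

section probs
variable (w : Sym2 V → unitInterval) {c u a b : V}

omit [Fintype V] in
/-- The terminal part of a separation event is almost sure when all terminal–terminal pairs have weight `0`. [this work] -/
theorem real_termClosed_eq_one (hterm : ∀ x ∈ terms4 c u a b, ∀ y ∈ terms4 c u a b, x ≠ y → (w s(x, y) : ℝ) = 0)
    {T : Set (BondConfig V)} (hT : {ω : BondConfig V | ∀ x ∈ terms4 c u a b, ∀ y ∈ terms4 c u a b, x ≠ y → s(x, y) ∉ ω} ⊆ T) :
    (prodBernoulli w).real T = 1 := by
  set F : Finset (Sym2 V) := ((terms4 c u a b ×ˢ terms4 c u a b).filter fun xy => xy.1 ≠ xy.2).image fun xy => s(xy.1, xy.2) with hF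
  have hsub : {ω : BondConfig V | ∀ e ∈ F, e ∉ ω} ⊆ T := by
    refine Subset.trans (fun ω hω => ?_) hT
    intro x hx y hy hxy
    exact hω _ (Finset.mem_image.2 ⟨(x, y), Finset.mem_filter.2 ⟨Finset.mem_product.2 ⟨hx, hy⟩, hxy⟩, rfl⟩)
  have h1 : (prodBernoulli w).real {ω : BondConfig V | ∀ e ∈ F, e ∉ ω} = 1 := by
    rw [prodBernoulli_real_forall_notMem]
    refine Finset.prod_eq_one fun e he => ?_
    obtain ⟨⟨x, y⟩, hxy, rfl⟩ := Finset.mem_image.1 he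
    rw [Finset.mem_filter, Finset.mem_product] at hxy
    rw [hterm x hxy.1.1 y hxy.1.2 hxy.2]; ring
  refine le_antisymm measureReal_le_one ?_
  rw [← h1]
  exact measureReal_mono hsub

omit [Fintype V] in
/-- A configuration with all terminal–terminal pairs closed lies in every `tSep X` (`X ⊆ terms4`). [this work] -/
theorem termClosed_subset_tSep (X : Finset V) {ω : BondConfig V}
    (h : (∀ x ∈ terms4 c u a b, ∀ y ∈ terms4 c u a b, x ≠ y → s(x, y) ∉ ω) ∧ X ⊆ terms4 c u a b) : ω ∈ tSep X c u a b := by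
  intro x hx y hy
  exact h.1 x (h.2 hx) y (Finset.mem_sdiff.1 hy).1 (by rintro rfl; exact (Finset.mem_sdiff.1 hy).2 hx)

omit [Fintype V] in
/-- `tSep X` depends only on terminal pairs (`X ⊆ terms4`). [this work] -/
theorem tSep_dep {X : Finset V} (hX : X ⊆ terms4 c u a b) {ω ω' : BondConfig V}
    (hF : ∀ x ∈ terms4 c u a b, ∀ y ∈ terms4 c u a b, (s(x, y) ∈ ω ↔ s(x, y) ∈ ω')) :
    ω ∈ tSep X c u a b ↔ ω' ∈ tSep X c u a b := by
  simp only [tSep, mem_setOf_eq]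
  exact forall₂_congr fun x hx => forall₂_congr fun y hy => not_congr (hF x (hX hx) y (Finset.mem_sdiff.1 hy).1)

/-- Generic product formula for `(tSep X ∩ tSep Y ∩ tSep Z) ∩ ⋂_h H h` on a bipartite hub graph: the terminal part is a.s., so the
probability is `Π_h P(H h)`. [this work] -/
theorem real_tInter3_hInter {X Y Z : Finset V} (hX : X ⊆ terms4 c u a b) (hY : Y ⊆ terms4 c u a b) (hZ : Z ⊆ terms4 c u a b)
    (hterm : ∀ x ∈ terms4 c u a b, ∀ y ∈ terms4 c u a b, x ≠ y → (w s(x, y) : ℝ) = 0)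
    {H : V → Set (BondConfig V)} (hH : ∀ h ∈ hubs4 c u a b, DeterminedBy (H h) (↑(star4 c u a b h) : Set (Sym2 V))) :
    (prodBernoulli w).real ((tSep X c u a b ∩ tSep Y c u a b ∩ tSep Z c u a b) ∩ ⋂ h ∈ hubs4 c u a b, H h) =
      ∏ h ∈ hubs4 c u a b, (prodBernoulli w).real (H h) := by
  rw [real_tInter_hInter w (fun ω ω' hF => ?_) hH, real_termClosed_eq_one w hterm, one_mul]
  · intro ω hω
    exact ⟨⟨termClosed_subset_tSep X ⟨hω, hX⟩, termClosed_subset_tSep Y ⟨hω, hY⟩⟩, termClosed_subset_tSep Z ⟨hω, hZ⟩⟩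
  · simp only [mem_inter_iff]
    rw [tSep_dep hX hF, tSep_dep hY hF, tSep_dep hZ hF]

/-- `P(sepEv{c} ∩ sepEv{b}) = Π_h P(hSep{c} ∩ hSep{b})` on a bipartite hub graph. [this work] -/
theorem real_sep_cb (hterm : ∀ x ∈ terms4 c u a b, ∀ y ∈ terms4 c u a b, x ≠ y → (w s(x, y) : ℝ) = 0) :
    (prodBernoulli w).real (sepEv {c} c u a b ∩ sepEv {b} c u a b) =
      ∏ h ∈ hubs4 c u a b, (prodBernoulli w).real (hSep {c} c u a b h ∩ hSep {b} c u a b h) := by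
  have hc : ({c} : Finset V) ⊆ terms4 c u a b := by simp [terms4]
  have hb : ({b} : Finset V) ⊆ terms4 c u a b := by simp [terms4]
  have hset : sepEv {c} c u a b ∩ sepEv {b} c u a b =
      (tSep {c} c u a b ∩ tSep {b} c u a b ∩ tSep {b} c u a b) ∩ ⋂ h ∈ hubs4 c u a b, (hSep {c} c u a b h ∩ hSep {b} c u a b h) := by
    ext ω; simp only [sepEv, mem_inter_iff, mem_iInter]
    constructor
    · rintro ⟨⟨h1, h2⟩, h3, h4⟩; exact ⟨⟨⟨h1, h3⟩, h3⟩, fun h hh => ⟨h2 h hh, h4 h hh⟩⟩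
    · rintro ⟨⟨⟨h1, h3⟩, -⟩, h2⟩; exact ⟨⟨h1, fun h hh => (h2 h hh).1⟩, h3, fun h hh => (h2 h hh).2⟩
  rw [hset]
  exact real_tInter3_hInter w hc hb hb hterm fun h _ => (determinedBy_hSep hc h).inter (determinedBy_hSep hb h)

/-- `P(sepEv{c} ∩ sepEv{b} ∩ sepEv{u}) = Π_h P(hSep{c} ∩ hSep{b} ∩ hSep{u})`. [this work] -/
theorem real_sep_cbu (hterm : ∀ x ∈ terms4 c u a b, ∀ y ∈ terms4 c u a b, x ≠ y → (w s(x, y) : ℝ) = 0) :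
    (prodBernoulli w).real (sepEv {c} c u a b ∩ sepEv {b} c u a b ∩ sepEv {u} c u a b) =
      ∏ h ∈ hubs4 c u a b, (prodBernoulli w).real (hSep {c} c u a b h ∩ hSep {b} c u a b h ∩ hSep {u} c u a b h) := by
  have hc : ({c} : Finset V) ⊆ terms4 c u a b := by simp [terms4]
  have hb : ({b} : Finset V) ⊆ terms4 c u a b := by simp [terms4]
  have hu : ({u} : Finset V) ⊆ terms4 c u a b := by simp [terms4]
  have hset : sepEv {c} c u a b ∩ sepEv {b} c u a b ∩ sepEv {u} c u a b =
      (tSep {c} c u a b ∩ tSep {b} c u a b ∩ tSep {u} c u a b) ∩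
        ⋂ h ∈ hubs4 c u a b, (hSep {c} c u a b h ∩ hSep {b} c u a b h ∩ hSep {u} c u a b h) := by
    ext ω; simp only [sepEv, mem_inter_iff, mem_iInter]
    constructor
    · rintro ⟨⟨⟨h1, h2⟩, h3, h4⟩, h5, h6⟩; exact ⟨⟨⟨h1, h3⟩, h5⟩, fun h hh => ⟨⟨h2 h hh, h4 h hh⟩, h6 h hh⟩⟩
    · rintro ⟨⟨⟨h1, h3⟩, h5⟩, h2⟩
      exact ⟨⟨⟨h1, fun h hh => (h2 h hh).1.1⟩, h3, fun h hh => (h2 h hh).1.2⟩, h5, fun h hh => (h2 h hh).2⟩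
  rw [hset]
  exact real_tInter3_hInter w hc hb hu hterm fun h _ =>
    ((determinedBy_hSep hc h).inter (determinedBy_hSep hb h)).inter (determinedBy_hSep hu h)

/-- `P(sepEv{u,a}) = Π_h P(hSep{u,a})`. [this work] -/
theorem real_sep_ua (hterm : ∀ x ∈ terms4 c u a b, ∀ y ∈ terms4 c u a b, x ≠ y → (w s(x, y) : ℝ) = 0) :
    (prodBernoulli w).real (sepEv {u, a} c u a b) = ∏ h ∈ hubs4 c u a b, (prodBernoulli w).real (hSep {u, a} c u a b h) := by
  have hua : ({u, a} : Finset V) ⊆ terms4 c u a b := by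
    intro x hx; simp only [Finset.mem_insert, Finset.mem_singleton] at hx; rcases hx with rfl | rfl <;> simp [terms4]
  have hset : sepEv {u, a} c u a b =
      (tSep {u, a} c u a b ∩ tSep {u, a} c u a b ∩ tSep {u, a} c u a b) ∩ ⋂ h ∈ hubs4 c u a b, hSep {u, a} c u a b h := by
    ext ω; simp only [sepEv, mem_inter_iff, mem_iInter, and_self]
  rw [hset]
  exact real_tInter3_hInter w hua hua hua hterm fun h _ => determinedBy_hSep hua h

/-- `P(sepEv{u} ∩ sepEv{a}) = Π_h P(hSep{u} ∩ hSep{a})`. [this work] -/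
theorem real_sep_u_a (hterm : ∀ x ∈ terms4 c u a b, ∀ y ∈ terms4 c u a b, x ≠ y → (w s(x, y) : ℝ) = 0) :
    (prodBernoulli w).real (sepEv {u} c u a b ∩ sepEv {a} c u a b) =
      ∏ h ∈ hubs4 c u a b, (prodBernoulli w).real (hSep {u} c u a b h ∩ hSep {a} c u a b h) := by
  have hu : ({u} : Finset V) ⊆ terms4 c u a b := by simp [terms4]
  have ha : ({a} : Finset V) ⊆ terms4 c u a b := by simp [terms4]
  have hset : sepEv {u} c u a b ∩ sepEv {a} c u a b =
      (tSep {u} c u a b ∩ tSep {a} c u a b ∩ tSep {a} c u a b) ∩ ⋂ h ∈ hubs4 c u a b, (hSep {u} c u a b h ∩ hSep {a} c u a b h) := by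
    ext ω; simp only [sepEv, mem_inter_iff, mem_iInter]
    constructor
    · rintro ⟨⟨h1, h2⟩, h3, h4⟩; exact ⟨⟨⟨h1, h3⟩, h3⟩, fun h hh => ⟨h2 h hh, h4 h hh⟩⟩
    · rintro ⟨⟨⟨h1, h3⟩, -⟩, h2⟩; exact ⟨⟨h1, fun h hh => (h2 h hh).1⟩, h3, fun h hh => (h2 h hh).2⟩
  rw [hset]
  exact real_tInter3_hInter w hu ha ha hterm fun h _ => (determinedBy_hSep hu h).inter (determinedBy_hSep ha h)

/-- `P(sepEv{c}) = Π_h P(hSep{c})`. [this work] -/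
theorem real_sep_c (hterm : ∀ x ∈ terms4 c u a b, ∀ y ∈ terms4 c u a b, x ≠ y → (w s(x, y) : ℝ) = 0) :
    (prodBernoulli w).real (sepEv {c} c u a b) = ∏ h ∈ hubs4 c u a b, (prodBernoulli w).real (hSep {c} c u a b h) := by
  have hc : ({c} : Finset V) ⊆ terms4 c u a b := by simp [terms4]
  have hset : sepEv {c} c u a b =
      (tSep {c} c u a b ∩ tSep {c} c u a b ∩ tSep {c} c u a b) ∩ ⋂ h ∈ hubs4 c u a b, hSep {c} c u a b h := by
    ext ω; simp only [sepEv, mem_inter_iff, mem_iInter, and_self]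
  rw [hset]
  exact real_tInter3_hInter w hc hc hc hterm fun h _ => determinedBy_hSep hc h

/-- **`P(Q) = Π_h (n+p)_h − Π_h n_h`** on a bipartite 4-terminal hub graph (products written with the hub-event probabilities;
closed forms in `…SuperTerminalQuarticHubProb`). [this work] -/
theorem real_Q (hcu : c ≠ u) (hca : c ≠ a) (hcb : c ≠ b) (hua : u ≠ a) (hub : u ≠ b) (hab : a ≠ b)
    (hcov : ∀ x ∈ hubs4 c u a b, ∀ y ∈ hubs4 c u a b, x ≠ y → (w s(x, y) : ℝ) = 0)
    (hterm : ∀ x ∈ terms4 c u a b, ∀ y ∈ terms4 c u a b, x ≠ y → (w s(x, y) : ℝ) = 0) :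
    (prodBernoulli w).real (openConn u a ∩ (openConn u b)ᶜ ∩ ((openConn c u)ᶜ ∩ (openConn c a)ᶜ ∩ (openConn c b)ᶜ) : Set (BondConfig V)) =
      (∏ h ∈ hubs4 c u a b, (prodBernoulli w).real (hSep {c} c u a b h ∩ hSep {b} c u a b h)) -
        ∏ h ∈ hubs4 c u a b, (prodBernoulli w).real (hSep {c} c u a b h ∩ hSep {b} c u a b h ∩ hSep {u} c u a b h) := by
  rw [real_congr_off_null w (real_bad4 w hcov) (fun ω hN => memQ_iff hcu hca hcb hua hub hab hN),
    measureReal_sdiff inter_subset_left MeasurableSet.of_discrete, real_sep_cb w hterm, real_sep_cbu w hterm]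

/-- `sepEv{u} ∩ sepEv{a} ⊆ sepEv{u,a}` (as cylinder sets). [this work] -/
theorem sep_u_a_subset_ua : sepEv {u} c u a b ∩ sepEv {a} c u a b ⊆ sepEv {u, a} c u a b := by
  rintro ω ⟨⟨hTu, hHu⟩, ⟨hTa, hHa⟩⟩
  simp only [mem_iInter] at hHu hHa
  have hsub : ∀ {y z : V}, y ∈ terms4 c u a b \ {u, a} → (z = u ∨ z = a) → y ∈ terms4 c u a b \ {z} := by
    intro y z hy hz
    have hy' := Finset.mem_sdiff.1 hy
    refine Finset.mem_sdiff.2 ⟨hy'.1, fun h => hy'.2 ?_⟩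
    rw [Finset.mem_singleton] at h
    subst h
    rcases hz with rfl | rfl <;> simp
  refine ⟨fun x hx y hy => ?_, ?_⟩
  · simp only [Finset.mem_insert, Finset.mem_singleton] at hx
    rcases hx with rfl | rfl
    · exact hTu x (Finset.mem_singleton_self _) y (hsub hy (Or.inl rfl))
    · exact hTa x (Finset.mem_singleton_self _) y (hsub hy (Or.inr rfl))
  · simp only [mem_iInter]
    intro h hh
    have hu' := hHu h hh
    have ha' := hHa h hh
    simp only [hSep, mem_setOf_eq, Finset.mem_singleton, exists_eq_left, Finset.mem_insert] at hu' ha' ⊢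
    rintro ⟨⟨x, hx, hxh⟩, y, hy, hyh⟩
    rcases hx with rfl | rfl
    · exact hu' ⟨hxh, y, hsub hy (Or.inl rfl), hyh⟩
    · exact ha' ⟨hxh, y, hsub hy (Or.inr rfl), hyh⟩

/-- **`P(A) = Π_h (n+p+d)_h − Π_h (n+d)_h`** on a bipartite 4-terminal hub graph. [this work] -/
theorem real_A (hcu : c ≠ u) (hca : c ≠ a) (hua : u ≠ a) (hub : u ≠ b) (hab : a ≠ b)
    (hcov : ∀ x ∈ hubs4 c u a b, ∀ y ∈ hubs4 c u a b, x ≠ y → (w s(x, y) : ℝ) = 0)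
    (hterm : ∀ x ∈ terms4 c u a b, ∀ y ∈ terms4 c u a b, x ≠ y → (w s(x, y) : ℝ) = 0) :
    (prodBernoulli w).real (openConn u a ∩ (openConn u b)ᶜ ∩ ((openConn c u)ᶜ ∩ (openConn c a)ᶜ) : Set (BondConfig V)) =
      (∏ h ∈ hubs4 c u a b, (prodBernoulli w).real (hSep {u, a} c u a b h)) -
        ∏ h ∈ hubs4 c u a b, (prodBernoulli w).real (hSep {u} c u a b h ∩ hSep {a} c u a b h) := by
  rw [real_congr_off_null w (real_bad4 w hcov) (fun ω hN => memA_iff hcu hca hua hub hab hN),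
    measureReal_sdiff sep_u_a_subset_ua MeasurableSet.of_discrete, real_sep_ua w hterm, real_sep_u_a w hterm]

/-- **`P(C) = Π_h γ_h`** on a bipartite 4-terminal hub graph. [this work] -/
theorem real_C (hcu : c ≠ u) (hca : c ≠ a) (hcb : c ≠ b)
    (hcov : ∀ x ∈ hubs4 c u a b, ∀ y ∈ hubs4 c u a b, x ≠ y → (w s(x, y) : ℝ) = 0)
    (hterm : ∀ x ∈ terms4 c u a b, ∀ y ∈ terms4 c u a b, x ≠ y → (w s(x, y) : ℝ) = 0) :
    (prodBernoulli w).real ((openConn c u)ᶜ ∩ (openConn c a)ᶜ ∩ (openConn c b)ᶜ : Set (BondConfig V)) =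
      ∏ h ∈ hubs4 c u a b, (prodBernoulli w).real (hSep {c} c u a b h) := by
  rw [real_congr_off_null w (real_bad4 w hcov) (fun ω hN => memC_iff hcu hca hcb hN), real_sep_c w hterm]

end probs




end Summit.CriticalPhenomena.PercolationContinuityZ3.Theorems.SuperTerminalQuarticHubCylinders
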